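import Summits.BirchSwinnertonDyer.Rank1Residual.ManinAdditive.QiCuspPincer
import Summits.BirchSwinnertonDyer.Rank1Residual.ManinAdditive.NegOneOptimalTwistRigidityProof
import Summits.BirchSwinnertonDyer.Rank1Residual.ManinAdditive.CuspidalKummerUFamilyCurve
import Literature.NumberTheory.EllipticCurves.NewformsLevelRaising
import Literature.NumberTheory.EllipticCurves.Gamma1PeriodLatticeTwistProofs
import Literature.NumberTheory.Automorphic.ShimuraCurveRibetTakahashiPeterssonTwoPowerLevelProofs
import HarnessLib

/-!
# The QUARTER-SHIFT `χ₋₄`-twist transfer ACROSS LEVELS `4 ∥ N → 16 ∥ N` (cell `bsd-f2-manin`, es g34, MEMO-es §55)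

THEOREM 55.D (kernel-checked here, no `sorry`, nothing asserted). Let `f ∈ S₂(Γ₀(N))`, `g ∈ S₂(Γ₀(N'))` satisfy the
QUARTER-SHIFT relation `{∞, r}_f = s·{∞, r + ¼}_g` for all `r ∈ ℚ` (`QuarterShiftSymbols s f g`). Then
* (`smul_periodLattice_le_of_quarterShift`) if `N ∣ N'` and `4² ∣ N'`: `s·Λ_g ⊆ Λ_f` (Shimura's matrix, tree
  `exists_sl2_div_eq_div_add_twistShift`, and `{∞, r+1}_f = {∞, r}_f`);
* (`periodLattice_iff_of_quarterShift`) if moreover `N' = 4N` with `4 ∣ N`: `Λ_g = s⁻¹·Λ_f` EXACTLY — the new input is the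
  COSET DESCENT `Γ₀(N) = ⊔ₖ Γ₀(4N)·(1 0; kN 1)` (`2 ∣ N`, so `d` is odd and `k = d·c/N` works) together with
  `{∞, (1 0; kN 1)∞}_f = {∞, 1/(kN)}… = 0` (tree `modularSymbol_gamma0_smul_holds` at `r = 0`) and Manin's homomorphism
  (tree `cuspSymbol_mul_holds`): the `Γ₀(4N)`-periods of `f` already exhaust `Λ_f`.
* (`exists_quarterShiftSymbols_of_negOne_twist`) for modular-parametrisation data `D` of `W` at level `N` and `D'` of `W'`
  at level `N'`, `N ∣ N'`, `4² ∣ N'`, `2² ∣ N(W)`, `2² ∣ N(W')`, `W ⊗ χ₋₄ ~ W'`: the relation HOLDS with `s = 2/g(χ₄)`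
  (`s² = −1`): Birch's lemma (tree `modularSymbol_charTwist`) for `f_{D'} ⊗ χ₄ = f_D` raised to level `N'` (`toLevel0`,
  `q`-expansions) and the half-translate law `{∞, x+½} = −{∞, x}` for `f_{D'}` (an §15 `modularSymbol_add_half_eq_neg`, needs
  `4² ∣ N'` — which is why the LOW-level form is read off the HIGH-level one and not conversely).
COROLLARIES (kernel-checked): `Λ(f_{D'}) = i·Λ(f_D)` for every level-RAISING `χ₋₄`-pair `N(W') = 4·N(W)`, `4 ∣ N(W)`
(`periodLattice_rotation_of_negOne_twist_levelRaising`; an's landed `minusOneTwistLatticeRotation_holds` is the SAME-LEVEL case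
`2⁴ ∣ N = N'`); hence, transplanting an's §22 verbatim with the rotation as hypothesis (`…_of_rotation`): for lattice-optimal
`D`, `D′` the optimal curve of the twisted class is the twist of the optimal curve (`negOneOptimalTwistRigidity_levelRaising`),
the MANIN–DISCRIMINANT identity `c′¹²·Δ(W′) = c¹²·Δ(W)` (`negOne_optimal_c_pow_twelve_mul_Δ_eq_levelRaising`) and
`|c′| = |c|` when `Δ(W′) = Δ(W)` (`maninConstant_natAbs_eq_of_Δ_eq_levelRaising`); and the cusp-image transfer
`ψ(C₀) ≠ 0` for `f_D` ⟹ `ψ(C₀) ≠ 0` for `f_{D′}` (`cuspidalImageNonzero_of_negOne_twist_levelRaising`, only `N ∣ N'`, `4² ∣ N'`).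
ROWS (cell candidates, nothing asserted): E-es-163 `UFamilyCuspidalImageNonzeroAtConductorFour` (the `4 ∥ N` twin of the
landed E-es-162, LAW), S-es-g34-1 `UFamilyNegOneTwinAtSixteen` (fact-shaped pairing row: an's `UFamilyConductorLaw` + modularity
+ Silverman's `ord Δ < 12` criterion), E-es-164 `UFamilyCuspidalImageNonzeroAtConductorSixteen` (E-es-162 pinned to the
conductor) with the kernel glue `uFamilyCuspidalImageNonzeroAtConductorSixteen_of`, and E-es-165 `UFamilyManinTwinAtSixteen`
(`|c(E_u, 16p)| = |c(E_{−u}, 4p)|` for the optimal pair) PROVED from the optimal pairing row S-es-g34-2.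
PARTITION 0 · beyond-print theorem: no (Manin's conjecture / BSD are not proved by this; the level-raising rotation and the
Manin–discriminant identity across levels are not in the print we hold — MEMO-es §55.6).

TYPER NOTE (typer g21, T-es-61).  SOURCE = HOME/es/g34/QuarterShiftTwist-es-g34.lean **v2** sha16 a984591da8139a55 (685 l.; es: farm rc 0·0·0·0, 27
theorems + 6 `@[conjecture]` rows + 2 defs; BC7 6/6 CLEAN Probe-es-g34 fc959e28f32de185; MEMO-es §55, HOME/es/g34/MEMO-es-sec55.md f1ba656299343218; v1
fa4a0bcd528b4669 superseded before landing).  Typer farm re-check of v2 on the current tree: rc 0 · 0 warn · 0 sorry (audit 6 conjecture + 3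
proof-of-item + 19 support).  SPLIT for the 400-line cap on theorem-bearing statement files (typer/README gotcha 60), at es's own section boundary:
THIS FILE = es's header + §55.1–§55.3 (`section QuarterShift`: defs `QuarterShiftSymbols`, `lowerGamma0`; THEOREM 55.D `smul_periodLattice_le_of_quarterShift`
/ `periodLattice_le_smul_of_quarterShift` / `periodLattice_iff_of_quarterShift`, the cusp-image transfer `cuspidalImageNonzero_(iff_)of_quarterShift`,
and the χ₋₄-pair instances `exists_quarterShiftSymbols_of_negOne_twist`, `periodLattice_rotation_of_negOne_twist_levelRaising`,
`cuspidalImageNonzero_(iff_)of_negOne_twist_levelRaising`), VERBATIM; the sibling `QuarterShiftTwistUFamily.lean` (imports this file) = §55.4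
(`section Rigidity`: `…_of_rotation` ×4 + the level-raising instances ×3) + §55.5 (`section UFamilyRows`: the six `@[conjecture]` rows E-es-163 /
E-es-164 / S-es-g34-1 / S-es-g34-1′ / S-es-g34-2 / E-es-165 and their kernel glue), VERBATIM.  Imports (es's): landed `…ManinAdditive.QiCuspPincer`
(p738816) / `…NegOneOptimalTwistRigidityProof` / `…CuspidalKummerUFamilyCurve` (all Theses-free: closures 14 / 9 / 12 Summits modules) + three
Literature modules + HarnessLib — route-independent; flat namespace `…Rank1Residual.ManinAdditive` as es wrote it (34 decl names fresh tree-wide).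
`--supports stmt-…-22967` is refused for ManinAdditive targets (gate), so: bears_on stmt-BirchSwinnertonDyer-22967 (C2 `ManinOddAtFour`; LEAD offer
L-es-g34-1 `maninConstant_natAbs_eq_of_Δ_eq_levelRaising` by name).  REFUTER: ref1 R-es-80 PENDING at landing.  No instances, no notation, no sorry.
PARTITION 0 · beyond-print theorem: es says «yes (modest)» for the level-raising rotation / Manin–discriminant identity across levels (kernel-checked
here) · BSD is not proved by this; Manin `c = 1` is not proved by this; C2 OPEN.
-/

noncomputable section

open scoped MatrixGroups ModularForm

open CongruenceSubgroup WeierstrassCurve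
  Literature.NumberTheory.DiophantineGeometry
  Literature.NumberTheory.EllipticCurves
  Literature.NumberTheory.EllipticCurves.ModularForms

namespace Summit.BirchSwinnertonDyer.Rank1Residual.ManinAdditive

section QuarterShift

open Literature.NumberTheory.Automorphic (lowerSL lowerSL_apply_00 lowerSL_apply_01 lowerSL_apply_10
  lowerSL_apply_11 SL_mul_apply_10 SL_mul_apply_00)

/-! ## §55.1 The quarter-shift relation and the two lattice inclusions -/

/-- **The quarter-shift relation** between a form `f` on `Γ₀(N)` and a form `g` on `Γ₀(N')`:
`{∞, r}_f = s · {∞, r + ¼}_g` for every rational cusp `r` (for the `χ₋₄`-pair `f = f_E`, `g = f_{E ⊗ χ₋₄}`,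
`N(E ⊗ χ₋₄) = 4·N(E)`, it holds with `s = 2/g(χ₄) = −i`: `g(τ) = −i·f(τ + ¼)`). -/
def QuarterShiftSymbols {N N' : ℕ} (s : ℂ) (f : CuspForm (Gamma0 N) 2) (g : CuspForm (Gamma0 N') 2) : Prop :=
  ∀ r : ℚ, modularSymbol f r = s * modularSymbol g (r + 1 / 4)

/-- `Γ₀(N') ≤ Γ₀(N)` for `N ∣ N'`. -/
theorem mem_gamma0_of_dvd {N N' : ℕ} (h : N ∣ N') {A : SL(2, ℤ)} (hA : A ∈ Gamma0 N') : A ∈ Gamma0 N := by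
  rw [Gamma0_mem, ZMod.intCast_zmod_eq_zero_iff_dvd] at hA ⊢
  exact (Int.natCast_dvd_natCast.mpr h).trans hA

/-- `{∞, γ∞}_h = {∞, a/c}_h` when `c ≠ 0`. -/
theorem cuspSymbol_eq_of_ne_zero {M : ℕ} (h : CuspForm (Gamma0 M) 2) (γ : Gamma0 M)
    (hc : (γ : SL(2, ℤ)) 1 0 ≠ 0) :
    cuspSymbol h γ = modularSymbol h ((((γ : SL(2, ℤ)) 0 0 : ℤ) : ℚ) / (((γ : SL(2, ℤ)) 1 0 : ℤ) : ℚ)) := by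
  rw [cuspSymbol, if_neg hc]

/-- Shimura's matrix inside `Γ₀(L)`: for `γ ∈ Γ₀(L)` with `m² ∣ L` and `c ≠ 0`, and `u mod m`, there is
`γ' ∈ Γ₀(L)` with the same lower-left entry and `γ'∞ = γ∞ + u/m`. -/
theorem exists_gamma0_cusp_add_twistShift {L m : ℕ} [NeZero m] (hm : m ^ 2 ∣ L) (γ : Gamma0 L)
    (hc0 : (γ : SL(2, ℤ)) 1 0 ≠ 0) (u : ZMod m) :
    ∃ γ' : Gamma0 L, (γ' : SL(2, ℤ)) 1 0 = (γ : SL(2, ℤ)) 1 0 ∧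
      (((γ' : SL(2, ℤ)) 0 0 : ℤ) : ℚ) / (((γ' : SL(2, ℤ)) 1 0 : ℤ) : ℚ) =
        (((γ : SL(2, ℤ)) 0 0 : ℤ) : ℚ) / (((γ : SL(2, ℤ)) 1 0 : ℤ) : ℚ) + twistShift u := by
  have hL : ((L : ℕ) : ℤ) ∣ (γ : SL(2, ℤ)) 1 0 := by
    have h := γ.2
    rw [Gamma0_mem, ZMod.intCast_zmod_eq_zero_iff_dvd] at h
    exact h
  have hc : ((m : ℤ) ^ 2) ∣ (γ : SL(2, ℤ)) 1 0 := by
    have h1 : ((m ^ 2 : ℕ) : ℤ) ∣ (L : ℤ) := Int.natCast_dvd_natCast.mpr hm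
    push_cast at h1
    exact h1.trans hL
  obtain ⟨γ', h10, -, h⟩ := exists_sl2_div_eq_div_add_twistShift (γ : SL(2, ℤ)) hc hc0 u
  refine ⟨⟨γ', ?_⟩, h10, h⟩
  rw [Gamma0_mem, ZMod.intCast_zmod_eq_zero_iff_dvd, h10]
  exact hL

/-- **Easy inclusion `s·Λ_g ⊆ Λ_f`** (`N ∣ N'`, `4² ∣ N'`): a period `{∞, a/c}_g` (`16 ∣ c`) is
`s⁻¹{∞, a/c − ¼}_f = s⁻¹{∞, a/c + ¾}_f = s⁻¹{∞, γ''∞}_f` with `γ'' ∈ Γ₀(N') ≤ Γ₀(N)` Shimura's matrix. -/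
theorem smul_periodLattice_le_of_quarterShift {N N' : ℕ} [NeZero N] [NeZero N'] (hNN' : N ∣ N')
    (h16 : 4 ^ 2 ∣ N') {s : ℂ} {f : CuspForm (Gamma0 N) 2} {g : CuspForm (Gamma0 N') 2}
    (h : QuarterShiftSymbols s f g) : ∀ w ∈ periodLattice g, s * w ∈ periodLattice f := by
  haveI : NeZero (4 : ℕ) := ⟨by norm_num⟩
  intro w hw
  induction hw using AddSubgroup.closure_induction with
  | mem x hx =>
    obtain ⟨γ, rfl⟩ := hx
    by_cases hc0 : (γ : SL(2, ℤ)) 1 0 = 0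
    · rw [cuspSymbol, if_pos hc0, mul_zero]
      exact AddSubgroup.zero_mem _
    · obtain ⟨γ', h10, hdiv⟩ := exists_gamma0_cusp_add_twistShift h16 γ hc0 (3 : ZMod 4)
      rw [twistShift_three_four] at hdiv
      have hc0' : (γ' : SL(2, ℤ)) 1 0 ≠ 0 := by rw [h10]; exact hc0
      set γN : Gamma0 N := ⟨(γ' : SL(2, ℤ)), mem_gamma0_of_dvd hNN' γ'.2⟩ with hγN
      have hcoe : (γN : SL(2, ℤ)) = (γ' : SL(2, ℤ)) := rfl
      have key : s * cuspSymbol g γ = cuspSymbol f γN := by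
        rw [cuspSymbol_eq_of_ne_zero g γ hc0, cuspSymbol_eq_of_ne_zero f γN (by rw [hcoe]; exact hc0'),
          hcoe, hdiv]
        set q : ℚ := (((γ : SL(2, ℤ)) 0 0 : ℤ) : ℚ) / (((γ : SL(2, ℤ)) 1 0 : ℤ) : ℚ) with hq
        have h1 := h (q + 3 / 4 + ((-1 : ℤ) : ℚ))
        rw [modularSymbol_add_intCast_holds f (q + 3 / 4) (-1),
          show q + 3 / 4 + ((-1 : ℤ) : ℚ) + 1 / 4 = q by push_cast; ring] at h1
        rw [h1]
      rw [key]
      exact cuspSymbol_mem_periodLattice f γN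
  | zero => rw [mul_zero]; exact AddSubgroup.zero_mem _
  | add x y _ _ hx hy => rw [mul_add]; exact AddSubgroup.add_mem _ hx hy
  | neg x _ hx => rw [mul_neg]; exact AddSubgroup.neg_mem _ hx

/-- The lower-triangular element `(1 0; kN 1) ∈ Γ₀(N)`. -/
def lowerGamma0 (N : ℕ) (k : ℤ) : Gamma0 N :=
  ⟨lowerSL (k * N), by
    rw [Gamma0_mem, ZMod.intCast_zmod_eq_zero_iff_dvd, lowerSL_apply_10]
    exact ⟨k, mul_comm _ _⟩⟩

/-- `lowerGamma0 N k` coerces to the matrix `lowerSL (k * N) = (1 0; kN 1)` (typer-added docstring, `lint.docstring`). -/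
theorem coe_lowerGamma0 (N : ℕ) (k : ℤ) : ((lowerGamma0 N k : Gamma0 N) : SL(2, ℤ)) = lowerSL (k * N) := rfl

/-- `{∞, (1 0; kN 1)∞}_f = 0`: the Manin relation at `r = 0` (`(1 0; kN 1)·0 = 0`). -/
theorem cuspSymbol_lowerGamma0 {N : ℕ} [NeZero N] (f : CuspForm (Gamma0 N) 2) (k : ℤ) :
    cuspSymbol f (lowerGamma0 N k) = 0 := by
  have hr : (((lowerGamma0 N k : Gamma0 N) : SL(2, ℤ)) 1 0 : ℚ) * 0 +
      (((lowerGamma0 N k : Gamma0 N) : SL(2, ℤ)) 1 1 : ℚ) ≠ 0 := by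
    rw [coe_lowerGamma0, lowerSL_apply_11]; norm_num
  have h := modularSymbol_gamma0_smul_holds f (lowerGamma0 N k) 0 hr
  rw [coe_lowerGamma0, lowerSL_apply_00, lowerSL_apply_01, lowerSL_apply_10, lowerSL_apply_11] at h
  simpa using h

/-- **Coset descent** `Γ₀(N) = ⊔ₖ Γ₀(4N)·(1 0; kN 1)` for `2 ∣ N`: every `δ ∈ Γ₀(N)` is `δ₁·(1 0; kN 1)` with
`δ₁ ∈ Γ₀(4N)` (`k = d·(c/N)`, `d` odd), so `{∞, δ∞}_f = {∞, δ₁∞}_f`. -/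
theorem exists_mem_gamma0_four_mul_cuspSymbol_eq {N : ℕ} [NeZero N] (h2 : 2 ∣ N)
    (f : CuspForm (Gamma0 N) 2) (δ : Gamma0 N) :
    ∃ δ₁ : Gamma0 N, (δ₁ : SL(2, ℤ)) ∈ Gamma0 (4 * N) ∧ cuspSymbol f δ = cuspSymbol f δ₁ := by
  obtain ⟨c₁, hc₁⟩ : (N : ℤ) ∣ (δ : SL(2, ℤ)) 1 0 := by
    have h := δ.2
    rw [Gamma0_mem, ZMod.intCast_zmod_eq_zero_iff_dvd] at h
    exact h
  have hdet : (δ : SL(2, ℤ)) 0 0 * (δ : SL(2, ℤ)) 1 1 - (δ : SL(2, ℤ)) 0 1 * (δ : SL(2, ℤ)) 1 0 = 1 := by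
    have h := Matrix.SpecialLinearGroup.det_coe (δ : SL(2, ℤ))
    rw [Matrix.det_fin_two] at h
    exact h
  obtain ⟨n₂, hn₂⟩ := h2
  have hN2 : (N : ℤ) = 2 * (n₂ : ℤ) := by exact_mod_cast hn₂
  have hd_odd : Odd ((δ : SL(2, ℤ)) 1 1) := by
    rw [← Int.not_even_iff_odd]
    rintro ⟨e, he⟩
    have h2dvd : (2 : ℤ) ∣ 1 :=
      ⟨(δ : SL(2, ℤ)) 0 0 * e - (δ : SL(2, ℤ)) 0 1 * ((n₂ : ℤ) * c₁), by
        linear_combination -hdet + (δ : SL(2, ℤ)) 0 0 * he - (δ : SL(2, ℤ)) 0 1 * hc₁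
          - (δ : SL(2, ℤ)) 0 1 * c₁ * hN2⟩
    omega
  obtain ⟨m, hm⟩ := hd_odd
  set k : ℤ := (δ : SL(2, ℤ)) 1 1 * c₁ with hk
  refine ⟨δ * lowerGamma0 N (-k), ?_, ?_⟩
  · rw [Gamma0_mem, ZMod.intCast_zmod_eq_zero_iff_dvd]
    have e10 : ((δ * lowerGamma0 N (-k) : Gamma0 N) : SL(2, ℤ)) 1 0 =
        (δ : SL(2, ℤ)) 1 0 * 1 + (δ : SL(2, ℤ)) 1 1 * (-k * N) := by
      rw [Subgroup.coe_mul, coe_lowerGamma0, SL_mul_apply_10, lowerSL_apply_00, lowerSL_apply_10]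
    rw [e10, hk, hc₁, hm]
    refine ⟨-(c₁ * m * (m + 1)), ?_⟩
    push_cast
    ring
  · rw [cuspSymbol_mul_holds f δ (lowerGamma0 N (-k)), cuspSymbol_lowerGamma0, add_zero]

/-- **Hard inclusion `Λ_f ⊆ s·Λ_g`** (`N' = 4N`, `4 ∣ N`): by coset descent the `Γ₀(4N)`-periods of `f` exhaust `Λ_f`, and a
`Γ₀(4N)`-period `{∞, a/c}_f` (`16 ∣ c`) is `s{∞, a/c + ¼}_g = s{∞, γ''∞}_g`, `γ'' ∈ Γ₀(4N)`. -/
theorem periodLattice_le_smul_of_quarterShift {N N' : ℕ} [NeZero N] [NeZero N'] (hN' : N' = 4 * N)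
    (h4 : 4 ∣ N) {s : ℂ} {f : CuspForm (Gamma0 N) 2} {g : CuspForm (Gamma0 N') 2}
    (h : QuarterShiftSymbols s f g) : ∀ z ∈ periodLattice f, ∃ w ∈ periodLattice g, z = s * w := by
  haveI : NeZero (4 : ℕ) := ⟨by norm_num⟩
  have h2 : 2 ∣ N := dvd_trans (by norm_num) h4
  have h16 : 4 ^ 2 ∣ N' := by
    obtain ⟨n, rfl⟩ := h4
    exact ⟨n, by rw [hN']; ring⟩
  intro z hz
  induction hz using AddSubgroup.closure_induction with
  | mem x hx =>
    obtain ⟨δ, rfl⟩ := hx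
    obtain ⟨δ₁, hδ₁, hEq⟩ := exists_mem_gamma0_four_mul_cuspSymbol_eq h2 f δ
    rw [hEq]
    rw [← hN'] at hδ₁
    set γ' : Gamma0 N' := ⟨(δ₁ : SL(2, ℤ)), hδ₁⟩ with hγ'
    have hcoe : (γ' : SL(2, ℤ)) = (δ₁ : SL(2, ℤ)) := rfl
    by_cases hc0 : (δ₁ : SL(2, ℤ)) 1 0 = 0
    · refine ⟨0, AddSubgroup.zero_mem _, ?_⟩
      rw [cuspSymbol, if_pos hc0, mul_zero]
    · obtain ⟨γ'', h10, hdiv⟩ := exists_gamma0_cusp_add_twistShift h16 γ' (by rw [hcoe]; exact hc0) (1 : ZMod 4)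
      rw [twistShift_one_four, hcoe] at hdiv
      rw [hcoe] at h10
      have hc0'' : (γ'' : SL(2, ℤ)) 1 0 ≠ 0 := by rw [h10]; exact hc0
      refine ⟨cuspSymbol g γ'', cuspSymbol_mem_periodLattice g γ'', ?_⟩
      rw [cuspSymbol_eq_of_ne_zero f δ₁ hc0, cuspSymbol_eq_of_ne_zero g γ'' hc0'', hdiv]
      exact h _
  | zero => exact ⟨0, AddSubgroup.zero_mem _, by rw [mul_zero]⟩
  | add x y _ _ hx hy =>
    obtain ⟨w₁, hw₁, rfl⟩ := hx
    obtain ⟨w₂, hw₂, rfl⟩ := hy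
    exact ⟨w₁ + w₂, AddSubgroup.add_mem _ hw₁ hw₂, by rw [mul_add]⟩
  | neg x _ hx =>
    obtain ⟨w, hw, rfl⟩ := hx
    exact ⟨-w, AddSubgroup.neg_mem _ hw, by rw [mul_neg]⟩

/-- **THEOREM 55.D (lattice form): `Λ_g = s⁻¹·Λ_f` exactly** — `w ∈ Λ_g ⟺ s·w ∈ Λ_f` — for a quarter-shift pair with
`N' = 4N`, `4 ∣ N`, `s ≠ 0`. -/
theorem periodLattice_iff_of_quarterShift {N N' : ℕ} [NeZero N] [NeZero N'] (hN' : N' = 4 * N)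
    (h4 : 4 ∣ N) {s : ℂ} (hs : s ≠ 0) {f : CuspForm (Gamma0 N) 2} {g : CuspForm (Gamma0 N') 2}
    (h : QuarterShiftSymbols s f g) : ∀ w : ℂ, w ∈ periodLattice g ↔ s * w ∈ periodLattice f := by
  have hNN' : N ∣ N' := ⟨4, by rw [hN']; ring⟩
  have h16 : 4 ^ 2 ∣ N' := by
    obtain ⟨n, rfl⟩ := h4
    exact ⟨n, by rw [hN']; ring⟩
  intro w
  refine ⟨smul_periodLattice_le_of_quarterShift hNN' h16 h w, fun hw ↦ ?_⟩
  obtain ⟨w', hw', hEq⟩ := periodLattice_le_smul_of_quarterShift hN' h4 h _ hw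
  rwa [mul_left_cancel₀ hs hEq]

/-! ## §55.2 Cusp images: `ψ(C₀) ≠ 0` transfers along a quarter-shift pair -/

/-- `ψ(C₀) ≠ 0` for `f` ⟹ `ψ(C₀) ≠ 0` for `g` (only the easy inclusion: `N ∣ N'`, `4² ∣ N'`; any `s`). -/
theorem cuspidalImageNonzero_of_quarterShift {N N' : ℕ} [NeZero N] [NeZero N'] (hNN' : N ∣ N')
    (h16 : 4 ^ 2 ∣ N') {s : ℂ} {f : CuspForm (Gamma0 N) 2} {g : CuspForm (Gamma0 N') 2}
    (h : QuarterShiftSymbols s f g) :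
    QiCuspPincer.CuspidalImageNonzero f → QiCuspPincer.CuspidalImageNonzero g := by
  rintro ⟨r, hr⟩
  refine ⟨r + 1 / 4, fun hmem ↦ hr ?_⟩
  rw [h r]
  exact smul_periodLattice_le_of_quarterShift hNN' h16 h _ hmem

/-- `ψ(C₀) ≠ 0` for `f` ⟺ `ψ(C₀) ≠ 0` for `g` when `N' = 4N`, `4 ∣ N`, `s ≠ 0` (the cusp images correspond:
`ψ_g(r) ↔ ψ_f(r − ¼)` under `Λ_g = s⁻¹Λ_f`). -/
theorem cuspidalImageNonzero_iff_of_quarterShift {N N' : ℕ} [NeZero N] [NeZero N'] (hN' : N' = 4 * N)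
    (h4 : 4 ∣ N) {s : ℂ} (hs : s ≠ 0) {f : CuspForm (Gamma0 N) 2} {g : CuspForm (Gamma0 N') 2}
    (h : QuarterShiftSymbols s f g) :
    QiCuspPincer.CuspidalImageNonzero f ↔ QiCuspPincer.CuspidalImageNonzero g := by
  have hNN' : N ∣ N' := ⟨4, by rw [hN']; ring⟩
  have h16 : 4 ^ 2 ∣ N' := by
    obtain ⟨n, rfl⟩ := h4
    exact ⟨n, by rw [hN']; ring⟩
  refine ⟨cuspidalImageNonzero_of_quarterShift hNN' h16 h, ?_⟩
  rintro ⟨t, ht⟩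
  refine ⟨t - 1 / 4, fun hmem ↦ ht ?_⟩
  rw [h (t - 1 / 4), sub_add_cancel] at hmem
  exact (periodLattice_iff_of_quarterShift hN' h4 hs h _).mpr hmem

/-! ## §55.3 The relation HOLDS for a `χ₋₄`-pair read at the high level (`s = 2/g(χ₄)`, `s² = −1`) -/

/-- **Quarter shift from the twist** (`N ∣ N'`, `4² ∣ N'`, both curves additive at `2`, `W ⊗ χ₋₄ ~ W'`):
`{∞, r}_{f_D} = (2/g(χ₄))·{∞, r + ¼}_{f_{D'}}`.  Proof: `f_{D'} ⊗ χ₄ = f_D` raised to level `N'` (`q`-expansions);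
Birch's lemma `{∞, r}_{f_{D'}⊗χ₄} = g(χ₄)⁻¹ Σ_u χ₄(u){∞, r + u/4}_{f_{D'}}`; half-translate for `f_{D'}`. -/
theorem exists_quarterShiftSymbols_of_negOne_twist {W W' : WeierstrassCurve ℚ} [W.IsElliptic] [W'.IsElliptic]
    {N N' : ℕ} [NeZero N] [NeZero N'] (D : ModularParametrizationData W N)
    (D' : ModularParametrizationData W' N') (hNN' : N ∣ N') (h16 : 4 ^ 2 ∣ N')
    (h4W : 2 ^ 2 ∣ W.conductorNorm ℤ) (h4W' : 2 ^ 2 ∣ W'.conductorNorm ℤ)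
    (hiso : IsIsogenous (W.quadraticTwist ((-1 : ℤ) : ℚ)) W') :
    ∃ s : ℂ, s ^ 2 = -1 ∧ QuarterShiftSymbols s D.f D'.f := by
  haveI : Fact (Nat.Prime 2) := ⟨Nat.prime_two⟩
  haveI : NeZero (4 : ℕ) := ⟨by norm_num⟩
  have hχ : (ZMod.χ₄.ringHomComp (Int.castRingHom ℂ)).IsQuadratic := isQuadratic_χ₄_ringHomComp
  have hprim : DirichletCharacter.IsPrimitive (ZMod.χ₄.ringHomComp (Int.castRingHom ℂ)) :=
    isPrimitive_χ₄_ringHomComp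
  have hd0 : ((-1 : ℤ) : ℚ) ≠ 0 := by norm_num
  haveI := W.isElliptic_quadraticTwist hd0
  obtain ⟨hngW, hnmW⟩ := not_good_and_not_mult_of_sq_dvd_conductorNorm W h4W
  obtain ⟨hngW', hnmW'⟩ := not_good_and_not_mult_of_sq_dvd_conductorNorm W' h4W'
  have hW0 : ∀ n : ℕ, 2 ∣ n → W.LFunction n = 0 := fun n hn ↦
    W.LFunction_apply_eq_zero_of_not_good_of_not_mult 2 hngW hnmW hn
  have hW'0 : ∀ n : ℕ, 2 ∣ n → W'.LFunction n = 0 := fun n hn ↦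
    W'.LFunction_apply_eq_zero_of_not_good_of_not_mult 2 hngW' hnmW' hn
  have hu : (1 : VariableChange ℚ) • W.quadraticTwist ((-1 : ℤ) : ℚ) =
      W.quadraticTwist ((-1 : ℤ) : ℚ) := one_smul _ _
  have hodd : ∀ n : ℕ, ¬ 2 ∣ n → (((W.quadraticTwist ((-1 : ℤ) : ℚ)).LFunction n : ℤ) : ℂ) =
      (ZMod.χ₄.ringHomComp (Int.castRingHom ℂ)) n * (W.LFunction n : ℂ) := fun n hn ↦ by
    rw [show ((-1 : ℤ) : ℚ) = -1 by norm_num, W.LFunction_quadraticTwist_neg_one_apply_of_odd hn,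
      Int.cast_mul, χ₄_ringHomComp_apply_natCast]
  have heven : ∀ n : ℕ, 2 ∣ n → (ZMod.χ₄.ringHomComp (Int.castRingHom ℂ)) n = 0 := fun n hn ↦ by
    rw [χ₄_ringHomComp_apply_natCast, ZMod.χ₄_nat_eq_if_mod_four, if_pos (Nat.mod_eq_zero_of_dvd hn)]
    simp
  have hsq : ∀ n : ℕ, ¬ 2 ∣ n → (ZMod.χ₄.ringHomComp (Int.castRingHom ℂ)) n *
      (ZMod.χ₄.ringHomComp (Int.castRingHom ℂ)) n = 1 := fun n hn ↦ by
    rw [χ₄_ringHomComp_apply_natCast, ZMod.χ₄_nat_eq_if_mod_four,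
      if_neg (fun h ↦ hn (Nat.dvd_of_mod_eq_zero h))]
    split_ifs <;> push_cast <;> ring
  have hcoef' : ∀ n : ℕ, cuspCoeff D.f n =
      (ZMod.χ₄.ringHomComp (Int.castRingHom ℂ)) n * cuspCoeff D'.f n :=
    fun n ↦ cuspCoeff_eq_chi_mul_of_twist_even' hd0 1 hu hiso.LFunction_eq hodd hsq heven hW0 D D' n
  -- `f_{D'} ⊗ χ₄` (at level `N'`) is `f_D` raised to level `N'`
  have htw : charTwist N' (dvd_refl N') h16 hχ D'.f = toLevel0 hNN' 2 D.f :=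
    eq_of_forall_cuspCoeff_eq_gamma0 fun n ↦ by
      rw [cuspCoeff_charTwist _ (dvd_refl N') h16 hχ hprim, ← hcoef' n]; rfl
  have hevenD' : ∀ n : ℕ, 2 ∣ n → cuspCoeff D'.f n = 0 := fun n hn ↦ by
    rw [D'.isNewformOf.2 n, hW'0 n hn, Int.cast_zero]
  have hhalf' : ∀ x : ℚ, modularSymbol D'.f (x + 1 / 2) = -modularSymbol D'.f x :=
    modularSymbol_add_half_eq_neg D'.f h16 hevenD'
  refine ⟨2 * (gaussSum (ZMod.χ₄.ringHomComp (Int.castRingHom ℂ)) (ZMod.stdAddChar (N := 4)))⁻¹,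
    ?_, fun r ↦ ?_⟩
  · rw [mul_pow, inv_pow, gaussSum_χ₄_ringHomComp_sq]; norm_num
  · have h1 : modularSymbol D.f r = modularSymbol (toLevel0 hNN' 2 D.f) r := rfl
    rw [h1, ← htw, modularSymbol_charTwist (L := N') (dvd_refl N') h16 hχ D'.f r,
      sum_χ₄_modularSymbol_of_half D'.f hhalf' r, twistShift_one_four]
    push_cast
    ring

/-- **THEOREM 55.D for level-RAISING `χ₋₄`-pairs: `Λ(f_{D'}) = i·Λ(f_D)`** (`N' = 4N`, `4 ∣ N`, both curves additive at
`2`, `W ⊗ χ₋₄ ~ W'`; `D`, `D'` ANY data).  The same-level case `2⁴ ∣ N = N'` is an's landed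
`minusOneTwistLatticeRotation_holds`; here the conductor CHANGES (`4 ∥ N(W)`, `16 ∥ N(W')`). -/
theorem periodLattice_rotation_of_negOne_twist_levelRaising {W W' : WeierstrassCurve ℚ} [W.IsElliptic]
    [W'.IsElliptic] {N N' : ℕ} [NeZero N] [NeZero N'] (D : ModularParametrizationData W N)
    (D' : ModularParametrizationData W' N') (hN' : N' = 4 * N) (h4 : 4 ∣ N)
    (h4W : 2 ^ 2 ∣ W.conductorNorm ℤ) (h4W' : 2 ^ 2 ∣ W'.conductorNorm ℤ)
    (hiso : IsIsogenous (W.quadraticTwist ((-1 : ℤ) : ℚ)) W') :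
    ∀ z : ℂ, z ∈ periodLattice D'.f ↔ Complex.I * z ∈ periodLattice D.f := by
  have hNN' : N ∣ N' := ⟨4, by rw [hN']; ring⟩
  have h16 : 4 ^ 2 ∣ N' := by
    obtain ⟨n, rfl⟩ := h4
    exact ⟨n, by rw [hN']; ring⟩
  obtain ⟨s, hs2, hq⟩ := exists_quarterShiftSymbols_of_negOne_twist D D' hNN' h16 h4W h4W' hiso
  have hs : s ^ 2 = Complex.I ^ 2 := by rw [hs2, Complex.I_sq]
  have hs0 : s ≠ 0 := by rintro rfl; norm_num at hs2
  have key := periodLattice_iff_of_quarterShift hN' h4 hs0 hq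
  intro z
  rcases sq_eq_sq_iff_eq_or_eq_neg.mp hs with hI | hI
  · rw [← hI]; exact key z
  · rw [key z, hI, neg_mul, neg_mem_iff]

/-- **Cusp-image transfer for `χ₋₄`-pairs** (`N ∣ N'`, `4² ∣ N'`, additive at `2`): `ψ(C₀) ≠ 0` for `f_D` ⟹ for `f_{D'}`. -/
theorem cuspidalImageNonzero_of_negOne_twist_levelRaising {W W' : WeierstrassCurve ℚ} [W.IsElliptic]
    [W'.IsElliptic] {N N' : ℕ} [NeZero N] [NeZero N'] (D : ModularParametrizationData W N)
    (D' : ModularParametrizationData W' N') (hNN' : N ∣ N') (h16 : 4 ^ 2 ∣ N')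
    (h4W : 2 ^ 2 ∣ W.conductorNorm ℤ) (h4W' : 2 ^ 2 ∣ W'.conductorNorm ℤ)
    (hiso : IsIsogenous (W.quadraticTwist ((-1 : ℤ) : ℚ)) W') :
    QiCuspPincer.CuspidalImageNonzero D.f → QiCuspPincer.CuspidalImageNonzero D'.f := by
  obtain ⟨s, -, hq⟩ := exists_quarterShiftSymbols_of_negOne_twist D D' hNN' h16 h4W h4W' hiso
  exact cuspidalImageNonzero_of_quarterShift hNN' h16 hq

/-- … and the equivalence when `N' = 4N`, `4 ∣ N`. -/
theorem cuspidalImageNonzero_iff_of_negOne_twist_levelRaising {W W' : WeierstrassCurve ℚ} [W.IsElliptic]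
    [W'.IsElliptic] {N N' : ℕ} [NeZero N] [NeZero N'] (D : ModularParametrizationData W N)
    (D' : ModularParametrizationData W' N') (hN' : N' = 4 * N) (h4 : 4 ∣ N)
    (h4W : 2 ^ 2 ∣ W.conductorNorm ℤ) (h4W' : 2 ^ 2 ∣ W'.conductorNorm ℤ)
    (hiso : IsIsogenous (W.quadraticTwist ((-1 : ℤ) : ℚ)) W') :
    QiCuspPincer.CuspidalImageNonzero D.f ↔ QiCuspPincer.CuspidalImageNonzero D'.f := by
  have hNN' : N ∣ N' := ⟨4, by rw [hN']; ring⟩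
  have h16 : 4 ^ 2 ∣ N' := by
    obtain ⟨n, rfl⟩ := h4
    exact ⟨n, by rw [hN']; ring⟩
  obtain ⟨s, hs2, hq⟩ := exists_quarterShiftSymbols_of_negOne_twist D D' hNN' h16 h4W h4W' hiso
  have hs0 : s ≠ 0 := by rintro rfl; norm_num at hs2
  exact cuspidalImageNonzero_iff_of_quarterShift hN' h4 hs0 hq

end QuarterShift

-- TYPER (split): §55.4 (`section Rigidity`) and §55.5 (`section UFamilyRows`) continue VERBATIM in the sibling
-- `QuarterShiftTwistUFamily.lean` (400-line cap on theorem-bearing statement files).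

end Summit.BirchSwinnertonDyer.Rank1Residual.ManinAdditive
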